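import Mathlib
import Summits.ValiantsHypothesis.ValiantsHypothesis.Theorems.MonotoneRestorationOrbitRestorationQPStableForms
import Summits.ValiantsHypothesis.ValiantsHypothesis.Theorems.MonotoneRestorationMixingScaleDefs
import Summits.ValiantsHypothesis.ValiantsHypothesis.Theorems.MonotoneRestorationMixingScaleAlmostInvariantTerms
import HarnessLib

/-!
# M4b of the line `mixing-scale`: SMALL SPACES OF AFFINE FORMS STABLE UNDER THE EVEN MATRIX ACTION LIE IN `span(1, U)`

Route MonotoneRestoration, crux `OrbitRestorationQP` (stmt-ValiantsHypothesis-18293), line `mixing-scale` (val-idea-12, skeleton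
`Cruxes/OrbitRestorationQP/Lines/mixing_scale.lean`), statement **M4b** `SpanOneUAlt` (Theorems-side vocabulary `…MixingScaleDefs.lean`,
threshold `4·dim W + 8 ≤ n` as in rev 6 of the skeleton; rev 7 weakened it to `16·dim W + 8 ≤ n` for a coset-trick proof — the version
proved here IMPLIES that one), a hypothesis of the registered stub M4c `stub_polyScaleStructure`.  Landed BY NAME as `spanOneUAlt : SpanOneUAlt`
in namespace `Summit.ValiantsHypothesis.ValiantsHypothesis.Theorems.OrbitRestorationQPMixingScale`.

THE ARGUMENT (elementary, no representation theory; the `𝔄_n`-version of `StableForms.le_finrank_of_swap_moves` with 3-CYCLES in place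
of transpositions and the INDEPENDENT row/column actions in place of the diagonal one).  A COORDINATE ACTION is a homomorphism
`g : Sym_n → Sym(Y)` on positions with an equivariant coordinate `κ : Y → Fin n` such that a position is fixed as soon as its coordinate is
(rows: `κ = fst`; columns: `κ = snd`).  Let `W` be a space of affine forms of dimension `d`, stable under `g σ` for EVEN `σ`, `3d + 3 ≤ n`.
If a 3-cycle `c` (support `A`, `|A| = 3`) moved some `w ∈ W`, then `v := c·w − w ∈ W ∖ 0` has all its coefficients at positions with
coordinate outside `A` equal to zero; pick a position `P` with nonzero coefficient and `d + 1` EVEN permutations `π_i` carrying `A` into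
pairwise disjoint 3-blocks (parity is free: swap two images inside the block); the coefficient of `π_i·v` at `g(π_i) P` is that of `v` at
`P`, while that of `π_j·v` vanishes there (`κ` of the pulled-back position lies outside `A`), so the `π_i·v ∈ W` are independent — too
many (`le_finrank_of_moves`).  Hence every 3-cycle, so all of `𝔄_n` (`Equiv.Perm.closure_three_cycles_eq_alternating`), fixes `W`
pointwise (`vact_eq_self_of_finrank`).  For `W` stable under the even row AND column renamings, every `w ∈ W` is then fixed by
`𝔄_n × 𝔄_n`, which is transitive on the positions (`exists_even_perm_apply_eq`, `n ≥ 3`), so all linear coefficients of `w` agree and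
`w = c₀ + b·U ∈ span(1, U)` (`spanOneUAlt`).

Everything is proved (no named fact is used).  Honest framing: M4b is one M-sized input of the line; M4c/M5 and the rung
`ProductDepthRestorationQP (fun _ => 1)` stay OPEN; nothing here bears on VP ≠ VNP. [folklore; cite: KarninShpilka2009, §3]
-/

noncomputable section

open MvPolynomial Equiv

-- `Summit.ValiantsHypothesis.ValiantsHypothesis.…` is the tree's single-conjunct layout (Sub = Summit).
set_option linter.dupNamespace false

namespace Summit.ValiantsHypothesis.ValiantsHypothesis.Theorems.OrbitRestorationQPMixingScale

open LevelStructure ProductAction LinearSubalgebra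

/-! ### Coordinate actions: coefficients, and the counting step with 3-cycles -/
section CoordAction

variable {n : ℕ} {Y : Type} [Fintype Y] [DecidableEq Y]

omit [Fintype Y] [DecidableEq Y] in
/-- The coefficient of `x_y` in `vact g σ q` is the coefficient of `x_{(g σ)⁻¹ y}` in `q`. [folklore] -/
theorem coeff_single_vact (g : Perm (Fin n) →* Perm Y) (σ : Perm (Fin n)) (q : MvPolynomial Y ℂ) (y : Y) :
    coeff (Finsupp.single y 1) (vact (K := ℂ) g σ q) = coeff (Finsupp.single ((g σ)⁻¹ y) 1) q := by
  have h := coeff_rename_mapDomain (g σ) (g σ).injective q (Finsupp.single ((g σ)⁻¹ y) 1)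
  rw [Finsupp.mapDomain_single, show (g σ) ((g σ)⁻¹ y) = y from (g σ).apply_symm_apply y] at h
  rw [vact_apply]; exact h

omit [Fintype Y] [DecidableEq Y] in
/-- The constant coefficient is unchanged by `vact g σ`. [folklore] -/
theorem coeff_zero_vact (g : Perm (Fin n) →* Perm Y) (σ : Perm (Fin n)) (q : MvPolynomial Y ℂ) :
    coeff 0 (vact (K := ℂ) g σ q) = coeff 0 q := by
  have h := coeff_rename_mapDomain (g σ) (g σ).injective q 0
  rw [Finsupp.mapDomain_zero] at h
  rw [vact_apply]; exact h

/-- A polynomial of total degree `≤ 1` with vanishing constant and linear coefficients is zero. [folklore] -/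
theorem eq_zero_of_coeffs_vanish {v : MvPolynomial Y ℂ} (hv : v.totalDegree ≤ 1) (h0 : coeff 0 v = 0)
    (h1 : ∀ y, coeff (Finsupp.single y 1) v = 0) : v = 0 := by
  rw [HomogTools.eq_C_add_sum_of_totalDegree_le_one hv, h0, map_zero, zero_add]
  exact Finset.sum_eq_zero fun y _ => by rw [h1 y, map_zero, zero_mul]

/-- **Main step (the `𝔄_n` counting).**  Let `g` be a coordinate action (`κ` equivariant, a position with fixed coordinate is fixed), `W` a
finite-dimensional space of forms of degree `≤ 1` stable under `vact g σ` for EVEN `σ`.  If an even `c` supported on a set `A` with `|A| ≤ 3`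
containing two distinct elements `a ≠ b` moves some `w ∈ W`, then `m ≤ dim W` whenever `3m ≤ n`. [folklore] -/
theorem le_finrank_of_moves (g : Perm (Fin n) →* Perm Y) (κ : Y → Fin n) (hκ : ∀ (σ : Perm (Fin n)) (y : Y), κ (g σ y) = σ (κ y))
    (hfix : ∀ (σ : Perm (Fin n)) (y : Y), σ (κ y) = κ y → g σ y = y)
    {W : Submodule ℂ (MvPolynomial Y ℂ)} [FiniteDimensional ℂ W] (hdeg : ∀ w ∈ W, MvPolynomial.totalDegree w ≤ 1)
    (hstab : ∀ σ : Perm (Fin n), Perm.sign σ = 1 → ∀ w ∈ W, vact (K := ℂ) g σ w ∈ W)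
    {w : MvPolynomial Y ℂ} (hw : w ∈ W) {c : Perm (Fin n)} (hc : Perm.sign c = 1) {A : Finset (Fin n)}
    (hcA : ∀ x, x ∉ A → c x = x) (hA3 : A.card ≤ 3) {a b : Fin n} (ha : a ∈ A) (hb : b ∈ A) (hab : a ≠ b)
    (hmove : vact (K := ℂ) g c w ≠ w) {m : ℕ} (hroom : 3 * m ≤ n) : m ≤ Module.finrank ℂ W := by
  classical
  -- the moved difference
  set v := vact (K := ℂ) g c w - w with hv
  have hvW : v ∈ W := W.sub_mem (hstab c hc w hw) hw
  have hv0 : v ≠ 0 := fun h => hmove (sub_eq_zero.1 h)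
  have hv1 : v.totalDegree ≤ 1 := hdeg v hvW
  set cf : Y → ℂ := fun y => coeff (Finsupp.single y 1) v with hcf
  have hc0 : coeff 0 v = 0 := by rw [hv, coeff_sub, coeff_zero_vact, sub_self]
  -- coefficients vanish at positions whose coordinate is outside `A`
  have hsupp : ∀ y : Y, κ y ∉ A → cf y = 0 := by
    intro y hy
    have hcy : c⁻¹ (κ y) = κ y := by rw [Perm.inv_eq_iff_eq]; exact (hcA _ hy).symm
    have hgy : (g c)⁻¹ y = y := by rw [← map_inv]; exact hfix _ y hcy
    simp only [hcf, hv, coeff_sub, coeff_single_vact, hgy, sub_self]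
  -- a position with nonzero coefficient; its coordinate lies in `A`
  obtain ⟨P, hP⟩ : ∃ y, cf y ≠ 0 := by
    by_contra hall
    exact hv0 (eq_zero_of_coeffs_vanish hv1 hc0 fun y => not_not.1 fun h => hall ⟨y, h⟩)
  have hPA : κ P ∈ A := by by_contra h; exact hP (hsupp P h)
  -- blocks
  set ℓ := A.card with hℓ
  have hroom' : ℓ * m ≤ n := (Nat.mul_le_mul_right m hA3).trans hroom
  let idx : A ≃o Fin ℓ := (A.orderIsoOfFin rfl).symm
  have hbound : ∀ (i : Fin m) (j : Fin ℓ), ℓ * (i : ℕ) + j < n := by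
    intro i j
    have h1 : ℓ * (i : ℕ) + j < ℓ * (i + 1) := by rw [Nat.mul_succ]; exact Nat.add_lt_add_left j.2 _
    exact lt_of_lt_of_le h1 ((Nat.mul_le_mul_left ℓ (Nat.succ_le_of_lt i.2)).trans hroom')
  let blk : Fin m → Fin ℓ → Fin n := fun i j => ⟨ℓ * (i : ℕ) + j, hbound i j⟩
  have hblk_inj : ∀ i i' j j', blk i j = blk i' j' → i = i' ∧ j = j' := by
    intro i i' j j' h
    have h' : ℓ * (i : ℕ) + j = ℓ * (i' : ℕ) + j' := congrArg Fin.val h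
    have key : ∀ (x y x' y' : ℕ), y < ℓ → y' < ℓ → ℓ * x + y = ℓ * x' + y' → x < x' → False := by
      intro x y x' y' hy _ hxy hlt
      have : ℓ * x + y < ℓ * x' + y' :=
        calc ℓ * x + y < ℓ * x + ℓ := Nat.add_lt_add_left hy _
          _ = ℓ * (x + 1) := (Nat.mul_succ ℓ x).symm
          _ ≤ ℓ * x' := Nat.mul_le_mul_left ℓ hlt
          _ ≤ ℓ * x' + y' := Nat.le_add_right _ _
      omega
    have hi : (i : ℕ) = i' := by
      rcases lt_trichotomy (i : ℕ) i' with hlt | heq | hgt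
      · exact (key _ _ _ _ j.2 j'.2 h' hlt).elim
      · exact heq
      · exact (key _ _ _ _ j'.2 j.2 h'.symm hgt).elim
    refine ⟨Fin.ext hi, Fin.ext ?_⟩
    rw [hi] at h'; omega
  let f : Fin m → Fin n → Fin n := fun i x => if hx : x ∈ A then blk i (idx ⟨x, hx⟩) else x
  have hf_inj : ∀ i, Set.InjOn (f i) A := by
    intro i x hx y hy hxy
    simp only [f, Finset.mem_coe.1 hx, Finset.mem_coe.1 hy, dif_pos] at hxy
    have := (hblk_inj i i _ _ hxy).2
    have := idx.injective this
    exact congrArg Subtype.val this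
  -- the permutations, made EVEN by a swap inside the block
  choose π₀ hπ₀ using fun i => StableForms.exists_perm_extend (hf_inj i)
  have hπ₀A : ∀ (i) (x : Fin n) (hx : x ∈ A), π₀ i x = blk i (idx ⟨x, hx⟩) := by
    intro i x hx
    rw [hπ₀ i x hx]; simp only [f, dif_pos hx]
  let π : Fin m → Perm (Fin n) := fun i => if Perm.sign (π₀ i) = 1 then π₀ i else swap (π₀ i a) (π₀ i b) * π₀ i
  have hπsign : ∀ i, Perm.sign (π i) = 1 := by
    intro i
    by_cases h : Perm.sign (π₀ i) = 1
    · simp only [π, if_pos h]; exact h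
    · simp only [π, if_neg h]
      rw [map_mul, Perm.sign_swap ((π₀ i).injective.ne hab)]
      rcases Int.units_eq_one_or (Perm.sign (π₀ i)) with h1 | h1
      · exact absurd h1 h
      · rw [h1]; rfl
  have hπmem : ∀ (i) (x : Fin n), x ∈ A → ∃ j, π i x = blk i j := by
    intro i x hx
    by_cases h : Perm.sign (π₀ i) = 1
    · exact ⟨idx ⟨x, hx⟩, by simp only [π, if_pos h]; exact hπ₀A i x hx⟩
    · simp only [π, if_neg h, Perm.mul_apply, hπ₀A i x hx, hπ₀A i a ha, hπ₀A i b hb]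
      rw [swap_apply_def]
      split_ifs
      · exact ⟨_, rfl⟩
      · exact ⟨_, rfl⟩
      · exact ⟨_, rfl⟩
  have hπ_disj : ∀ i i', i ≠ i' → ∀ x ∈ A, ∀ y ∈ A, π i x ≠ π i' y := by
    intro i i' hii' x hx y hy h
    obtain ⟨j, hj⟩ := hπmem i x hx
    obtain ⟨j', hj'⟩ := hπmem i' y hy
    rw [hj, hj'] at h
    exact hii' (hblk_inj _ _ _ _ h).1
  -- the translates and their coefficients at the exclusive positions
  set u : Fin m → MvPolynomial Y ℂ := fun i => vact (K := ℂ) g (π i) v with hu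
  have huW : ∀ i, u i ∈ W := fun i => hstab _ (hπsign i) v hvW
  have hdiag : ∀ i, coeff (Finsupp.single (g (π i) P) 1) (u i) = cf P := by
    intro i
    simp only [hu, coeff_single_vact, hcf]
    rw [show (g (π i))⁻¹ (g (π i) P) = P from (g (π i)).symm_apply_apply P]
  have hoff : ∀ i j, i ≠ j → coeff (Finsupp.single (g (π i) P) 1) (u j) = 0 := by
    intro i j hij
    simp only [hu, coeff_single_vact]
    refine hsupp _ fun hmem => ?_
    have h1 : κ ((g (π j))⁻¹ (g (π i) P)) = (π j)⁻¹ (π i (κ P)) := by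
      rw [← map_inv, hκ, hκ]
    rw [h1] at hmem
    exact hπ_disj i j hij (κ P) hPA _ hmem ((π j).apply_symm_apply _).symm
  -- linear independence in the ambient space
  have hli : LinearIndependent ℂ u := by
    rw [linearIndependent_iff']
    intro S r hsum i hi
    have h := congrArg (coeff (Finsupp.single (g (π i) P) 1)) hsum
    rw [coeff_sum, coeff_zero, Finset.sum_eq_single i] at h
    · rw [coeff_smul, hdiag, smul_eq_mul] at h
      exact (mul_eq_zero.1 h).resolve_right hP
    · intro j _ hji
      rw [coeff_smul, hoff i j (Ne.symm hji), smul_zero]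
    · intro hi'; exact absurd hi hi'
  -- transfer into `W`
  have hli' : LinearIndependent ℂ (fun i => (⟨u i, huW i⟩ : W)) :=
    LinearIndependent.of_comp W.subtype (by exact hli)
  have := hli'.fintype_card_le_finrank
  rwa [Fintype.card_fin] at this

/-- **Small spaces of affine forms stable under the EVEN permutations of a coordinate action are fixed pointwise by them**
(`3·dim W + 3 ≤ n`): every 3-cycle fixes `W` by `le_finrank_of_moves`, and the 3-cycles generate `𝔄_n`. [folklore] -/
theorem vact_eq_self_of_finrank (g : Perm (Fin n) →* Perm Y) (κ : Y → Fin n) (hκ : ∀ (σ : Perm (Fin n)) (y : Y), κ (g σ y) = σ (κ y))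
    (hfix : ∀ (σ : Perm (Fin n)) (y : Y), σ (κ y) = κ y → g σ y = y)
    {W : Submodule ℂ (MvPolynomial Y ℂ)} [FiniteDimensional ℂ W] (hdeg : ∀ w ∈ W, MvPolynomial.totalDegree w ≤ 1)
    (hstab : ∀ σ : Perm (Fin n), Perm.sign σ = 1 → ∀ w ∈ W, vact (K := ℂ) g σ w ∈ W)
    (hdim : 3 * Module.finrank ℂ W + 3 ≤ n) {σ : Perm (Fin n)} (hσ : Perm.sign σ = 1)
    {w : MvPolynomial Y ℂ} (hw : w ∈ W) : vact (K := ℂ) g σ w = w := by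
  classical
  -- every 3-cycle fixes `w`
  have h3 : ∀ c : Perm (Fin n), c.IsThreeCycle → vact (K := ℂ) g c w = w := by
    intro c hc
    by_contra hmove
    have hcard : c.support.card = 3 := hc.card_support
    obtain ⟨a, ha, b, hb, hab⟩ := Finset.one_lt_card.1 (by omega : 1 < c.support.card)
    have h := le_finrank_of_moves g κ hκ hfix hdeg hstab hw hc.sign (A := c.support)
      (fun x hx => Perm.notMem_support.1 hx) hcard.le ha hb hab hmove (m := Module.finrank ℂ W + 1) (by omega)
    omega
  -- the stabiliser of `w` is a subgroup containing the 3-cycles, hence `𝔄_n`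
  let H : Subgroup (Perm (Fin n)) :=
    { carrier := {ρ | vact (K := ℂ) g ρ w = w}
      mul_mem' := fun {x y} hx hy => by
        simp only [Set.mem_setOf_eq] at hx hy ⊢
        rw [map_mul, AlgEquiv.mul_apply, hy, hx]
      one_mem' := by simp only [Set.mem_setOf_eq, map_one, AlgEquiv.one_apply]
      inv_mem' := fun {x} hx => by
        simp only [Set.mem_setOf_eq] at hx ⊢
        conv_lhs => rw [← hx]
        rw [← AlgEquiv.mul_apply, ← map_mul, inv_mul_cancel, map_one, AlgEquiv.one_apply] }
  have hle : alternatingGroup (Fin n) ≤ H := by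
    rw [← Equiv.Perm.closure_three_cycles_eq_alternating, Subgroup.closure_le]
    intro c hc
    exact h3 c hc
  exact hle (Equiv.Perm.mem_alternatingGroup.2 hσ)

end CoordAction

/-! ### M4b -/
section M4b

variable {n : ℕ}

/-- For `n ≥ 3`, `𝔄_n` is transitive: some even permutation maps `p` to `q`. [folklore] -/
theorem exists_even_perm_apply_eq (hn : 3 ≤ n) (p q : Fin n) : ∃ σ : Perm (Fin n), Perm.sign σ = 1 ∧ σ p = q := by
  classical
  by_cases hpq : p = q
  · exact ⟨1, Perm.sign_one, by rw [hpq]; rfl⟩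
  have hlt : ({p, q} : Finset (Fin n)).card < (Finset.univ : Finset (Fin n)).card := by
    rw [Finset.card_univ, Fintype.card_fin, Finset.card_pair hpq]; omega
  obtain ⟨r, -, hr⟩ := Finset.exists_mem_notMem_of_card_lt_card hlt
  simp only [Finset.mem_insert, Finset.mem_singleton, not_or] at hr
  refine ⟨swap p q * swap q r, ?_, ?_⟩
  · rw [map_mul, Perm.sign_swap hpq, Perm.sign_swap (Ne.symm hr.2)]; rfl
  · rw [Perm.mul_apply, swap_apply_of_ne_of_ne hpq (Ne.symm hr.1), swap_apply_left]

/-- The coefficient of `x_P` in `mact σ τ w` is the coefficient of `x_{(σ⁻¹ P.1, τ⁻¹ P.2)}` in `w`. [folklore] -/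
theorem coeff_single_mact (σ τ : Perm (Fin n)) (w : MvPolynomial (Fin n × Fin n) ℂ) (P : Fin n × Fin n) :
    coeff (Finsupp.single P 1) (mact σ τ w) = coeff (Finsupp.single (σ⁻¹ P.1, τ⁻¹ P.2) 1) w := by
  have hinj : Function.Injective (fun p : Fin n × Fin n => (σ p.1, τ p.2)) := fun p q h =>
    Prod.ext (σ.injective (congrArg Prod.fst h)) (τ.injective (congrArg Prod.snd h))
  have h := coeff_rename_mapDomain (fun p : Fin n × Fin n => (σ p.1, τ p.2)) hinj w (Finsupp.single (σ⁻¹ P.1, τ⁻¹ P.2) 1)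
  rw [Finsupp.mapDomain_single] at h
  rw [show σ (σ⁻¹ P.1) = P.1 from σ.apply_symm_apply _, show τ (τ⁻¹ P.2) = P.2 from τ.apply_symm_apply _, Prod.mk.eta] at h
  rw [mact_apply]; exact h

/-- **M4b — `SpanOneUAlt`** (statement of the line, Theorems-side vocabulary, threshold `4·dim W + 8 ≤ n`): a finite-dimensional space `W`
of affine forms on the `n × n` matrix (`n > 8`), stable under the EVEN row/column renamings, with `4·dim W + 8 ≤ n`, lies in `span(1, U)`.
Rows and columns are coordinate actions, so `𝔄_n × 𝔄_n` fixes `W` pointwise (`vact_eq_self_of_finrank`); `𝔄_n × 𝔄_n` is transitive on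
the positions, so the linear coefficients of every `w ∈ W` agree. [folklore; cite: KarninShpilka2009, §3] -/
theorem spanOneUAlt : SpanOneUAlt := by
  classical
  intro n hn W _ hdeg hstab hdim w hw
  have hdeg' : ∀ v ∈ W, MvPolynomial.totalDegree v ≤ 1 := fun v hv => mem_deg1.1 (hdeg hv)
  have hstab' : ∀ (σ τ : Perm (Fin n)), Perm.sign σ = 1 → Perm.sign τ = 1 →
      ∀ v : MvPolynomial (Fin n × Fin n) ℂ, v ∈ W → mact σ τ v ∈ W :=
    fun σ τ hσ hτ v hv => hstab σ τ hσ hτ ⟨v, hv, rfl⟩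
  have hdim3 : 3 * Module.finrank ℂ W + 3 ≤ n := by omega
  -- rows and columns separately
  have hrow : ∀ σ : Perm (Fin n), Perm.sign σ = 1 → ∀ v ∈ W, vact (K := ℂ) rowHom σ v = v :=
    fun σ hσ v hv => vact_eq_self_of_finrank rowHom Prod.fst (fun _ _ => rfl) (fun _ _ h => Prod.ext h rfl) hdeg'
      (fun ρ hρ v hv => by rw [vact_rowHom_eq]; exact hstab' ρ 1 hρ Perm.sign_one v hv) hdim3 hσ hv
  have hcol : ∀ τ : Perm (Fin n), Perm.sign τ = 1 → ∀ v ∈ W, vact (K := ℂ) colHom τ v = v :=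
    fun τ hτ v hv => vact_eq_self_of_finrank colHom Prod.snd (fun _ _ => rfl) (fun _ _ h => Prod.ext rfl h) hdeg'
      (fun ρ hρ v hv => by rw [vact_colHom_eq]; exact hstab' 1 ρ Perm.sign_one hρ v hv) hdim3 hτ hv
  -- hence `𝔄_n × 𝔄_n` fixes `w`
  have hinv : ∀ σ τ : Perm (Fin n), Perm.sign σ = 1 → Perm.sign τ = 1 → mact σ τ w = w := by
    intro σ τ hσ hτ
    rw [mact_eq_row_mul_col, AlgEquiv.mul_apply, hcol τ hτ w hw, hrow σ hσ w hw]
  -- so all linear coefficients of `w` agree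
  set cf : Fin n × Fin n → ℂ := fun P => coeff (Finsupp.single P 1) w with hcf
  have hn3 : 3 ≤ n := by omega
  have hconst : ∀ P Q : Fin n × Fin n, cf P = cf Q := by
    intro P Q
    obtain ⟨σ, hσ, hσP⟩ := exists_even_perm_apply_eq hn3 P.1 Q.1
    obtain ⟨τ, hτ, hτP⟩ := exists_even_perm_apply_eq hn3 P.2 Q.2
    have h := congrArg (coeff (Finsupp.single Q 1)) (hinv σ τ hσ hτ)
    rw [coeff_single_mact] at h
    have h1 : σ⁻¹ Q.1 = P.1 := by rw [Perm.inv_eq_iff_eq]; exact hσP.symm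
    have h2 : τ⁻¹ Q.2 = P.2 := by rw [Perm.inv_eq_iff_eq]; exact hτP.symm
    rw [h1, h2, Prod.mk.eta] at h
    exact h
  -- assemble `w = c₀ · 1 + b · U`
  have hP₀ : 0 < n := by omega
  set P₀ : Fin n × Fin n := (⟨0, hP₀⟩, ⟨0, hP₀⟩)
  have hwU : w = C (coeff 0 w) + C (cf P₀) * U n := by
    rw [U, Finset.mul_sum]
    conv_lhs => rw [HomogTools.eq_C_add_sum_of_totalDegree_le_one (hdeg' w hw)]
    congr 1
    exact Finset.sum_congr rfl fun P _ => by rw [show coeff (Finsupp.single P 1) w = cf P from rfl, hconst P P₀]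
  rw [hwU]
  refine Submodule.add_mem _ ?_ ?_
  · rw [show C (coeff 0 w) = (coeff 0 w) • (C 1 : MvPolynomial (Fin n × Fin n) ℂ) by
      rw [smul_eq_C_mul, C_1, mul_one]]
    exact Submodule.smul_mem _ _ (Submodule.subset_span (Set.mem_insert _ _))
  · rw [← smul_eq_C_mul]
    exact Submodule.smul_mem _ _ (Submodule.subset_span (Set.mem_insert_of_mem _ rfl))

end M4b

end Summit.ValiantsHypothesis.ValiantsHypothesis.Theorems.OrbitRestorationQPMixingScale

end
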